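import Literature.Geometry.DiscreteGeometry.HeitmannRadinBoundaryCount
import HarnessLib

/-!
# Heitmann–Radin 1980, Theorem (2)(a), polygon form: a ground state fills its boundary polygon

Topic `Literature/Geometry/DiscreteGeometry`; sequel to `HeitmannRadinStructure.lean` (every
corner of a maximal configuration is tight or outer, `tight_or_outer_of_maximal`; all centres on
one triangular lattice, `exists_lattice_of_tight`) and `HeitmannRadinBoundaryCount.lean` ((2)(b)).
Heitmann–Radin [HeitmannRadin1980, Theorem (2)(a), p. 284]: "For any maximal configuration `C` of
`n` disks, `n ≥ 3`: (a) `C_g` has a simple closed polygonal boundary with vertices on a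
triangular lattice and `C_v` consists of all the lattice points inside and on this polygon."
The corollary "all centres are lattice points" is `HeitmannRadin1980_groundStates_holds`; this
file proves the remaining POLYGON CLAUSE: with the boundary polygon rendered, as in the tree's
proof of Harborth's theorem, by the boundary walk `Harborth.bdry` (a simple closed polygon,
`isSimplePolygon_bdry`, hence a Jordan loop `polygonLoop bdry period` with an `inside` and an
`outside`, `IsSimplePolygon.isJordanLoop`), the set of centres is EXACTLY the set of lattice
points lying inside or on that polygon (`HeitmannRadin_polygon`).

## Proof (the printed sentence "C_g decomposes R² into elementary polygons … only triangles",
read without faces)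

* §1 The polygon as a point set: it lies in the drawing, near a vertex it consists of the two
  boundary bonds, a bond that is not a boundary bond meets it only at its ends.
* §2 **The traced corners are outside**: the chain of corners (`exists_preconnected_corners`)
  together with the vertical ray below the lowest centre is connected, unbounded and misses the
  polygon.
* §3 **The inner side**: by the local two-sidedness of Jordan curves
  (`IsJordanLoop.subset_inside_or_of_nhds`) the reflex sector at a boundary vertex opposite to
  its outer corner lies inside.
* §4 **Every centre lies inside or on the polygon**: "inside-or-on" propagates along bonds (a
  non-boundary bond leaves a boundary vertex through the inner sector and never meets the
  polygon again), and a maximal configuration does not split (`not_splits_of_maximal`).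
* §5 Arithmetic of the triangular lattice `t + u(ℤ + ℤζ)`: distinct lattice points are `≥ 1`
  apart, the unit vectors are the six `u ζ^j`, a unit lattice bond carries no lattice point in
  its interior, two unit lattice bonds meet only at common ends.
* §6 **Every lattice point inside or on the polygon is a centre**: a lattice neighbour `y'` of a
  centre `y` lying inside-or-on is a centre — otherwise the direction `y → y'` sits strictly
  inside a corner at `y`, which is tight (impossible: a lattice direction strictly between two
  bond directions `π/3` apart) or outer (then the bond germ at `y` towards `y'` is outside, and
  the lattice bond `[y, y']`, which cannot cross the polygon, would end outside); so along the
  lattice ray from a missing lattice point `x` inside, no point is ever a centre and every point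
  stays inside-or-on (a unit lattice step cannot jump over the polygon) — absurd, the inside is
  bounded.

Everything here is proved; no new facts. [cite: HeitmannRadin1980, Theorem (2)(a)]
-/

noncomputable section

namespace Literature.Geometry.DiscreteGeometry

namespace Harborth

open Complex Set Finset Metric
open Literature.Topology.PlaneTopology
open scoped Real

variable {P : Finset ℂ}

section Polygon

variable {hne : P.Nonempty} {h2 : ∀ p ∈ P, 2 ≤ (nbrs P p).card}

/-! ## §1 The boundary polygon as a point set -/

/-- The boundary polygon (the trace of the loop `polygonLoop bdry period`) is the union of the
boundary bonds. [cite: HeitmannRadin1980, §4 (p. 284)] -/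
theorem range_bdryLoop_eq :
    Set.range (polygonLoop (bdry P hne h2) (period P hne h2)) =
      ⋃ i : ℤ, segment ℝ (bdry P hne h2 i) (bdry P hne h2 (i + 1)) :=
  range_polygonLoop _ period_pos

/-- The boundary polygon lies in the drawing `C_g` ("∂C_g ⊆ C_g"). [cite: HeitmannRadin1980, §4 (p. 284)] -/
theorem range_bdryLoop_subset_drawing :
    Set.range (polygonLoop (bdry P hne h2) (period P hne h2)) ⊆ drawing P := by
  rw [range_bdryLoop_eq]
  exact Set.iUnion_subset fun i => segment_subset_drawing (bdry_mem_darts i)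

/-- Boundary centres lie on the boundary polygon. [cite: HeitmannRadin1980, §4 (p. 284)] -/
theorem bdry_mem_range (m : ℤ) :
    bdry P hne h2 m ∈ Set.range (polygonLoop (bdry P hne h2) (period P hne h2)) := by
  rw [range_bdryLoop_eq]
  exact Set.mem_iUnion.2 ⟨m, left_mem_segment _ _ _⟩

/-- The boundary set lies on the boundary polygon. [cite: HeitmannRadin1980, §4 (p. 284)] -/
theorem bdrySet_subset_range :
    ((bdrySet P hne h2 : Finset ℂ) : Set ℂ) ⊆
      Set.range (polygonLoop (bdry P hne h2) (period P hne h2)) := by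
  intro x hx
  obtain ⟨m, -, rfl⟩ := Finset.mem_image.1 (Finset.mem_coe.1 hx)
  exact bdry_mem_range _

/-- **A centre on the boundary polygon is a boundary vertex** (`C_v ∩ ∂C_g` = the vertices of
the polygon): a third centre stays `> 1/2` away from every bond. [cite: HeitmannRadin1980, §4 (p. 284)] -/
theorem mem_bdrySet_of_mem_range (hP : IsHard P) {k : ℂ} (hk : k ∈ P)
    (hkR : k ∈ Set.range (polygonLoop (bdry P hne h2) (period P hne h2))) :
    k ∈ bdrySet P hne h2 := by
  rw [range_bdryLoop_eq] at hkR
  obtain ⟨i, hki⟩ := Set.mem_iUnion.1 hkR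
  by_cases h1 : k = bdry P hne h2 i
  · rw [h1]; exact bdry_mem_bdrySet _
  by_cases h1' : k = bdry P hne h2 (i + 1)
  · rw [h1']; exact bdry_mem_bdrySet _
  exfalso
  have := half_lt_norm_sub_of_mem_segment hP (bdry_mem i) (bdry_mem (i + 1)) hk h1 h1'
    (norm_bdry_succ_sub i) hki
  rw [sub_self, norm_zero] at this
  linarith

/-- Equal boundary centres sit at congruent indices, so the walk continues equally from them.
[cite: Harborth1974, p. 14] -/
theorem bdry_add_eq_of_bdry_eq (hP : IsHard P) (hns : ¬ Splits P) {i j : ℤ}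
    (h : bdry P hne h2 i = bdry P hne h2 j) (c : ℤ) :
    bdry P hne h2 (i + c) = bdry P hne h2 (j + c) := by
  apply bdry_eq_of_emod_eq
  have := emod_eq_of_bdry_eq hP hns h
  rw [Int.add_emod, this, ← Int.add_emod]

/-- **Near a boundary vertex the polygon consists of its two boundary bonds**: a point of the
boundary polygon within distance `1/2` of `bdry m` lies on `[bdry m, bdry (m-1)]` or on
`[bdry m, bdry (m+1)]`. [cite: HeitmannRadin1980, §4 (p. 284)] -/
theorem mem_segment_of_mem_range (hP : IsHard P) (hns : ¬ Splits P) (m : ℤ) {x : ℂ}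
    (hx : x ∈ Set.range (polygonLoop (bdry P hne h2) (period P hne h2)))
    (hxm : ‖x - bdry P hne h2 m‖ < 1 / 2) :
    x ∈ segment ℝ (bdry P hne h2 m) (bdry P hne h2 (m - 1)) ∨
      x ∈ segment ℝ (bdry P hne h2 m) (bdry P hne h2 (m + 1)) := by
  rw [range_bdryLoop_eq] at hx
  obtain ⟨i, hxi⟩ := Set.mem_iUnion.1 hx
  by_cases h1 : bdry P hne h2 m = bdry P hne h2 i
  · right
    have e := bdry_add_eq_of_bdry_eq hP hns h1 1
    rw [h1, e]; exact hxi
  by_cases h1' : bdry P hne h2 m = bdry P hne h2 (i + 1)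
  · left
    have e := bdry_add_eq_of_bdry_eq hP hns h1' (-1)
    rw [show i + 1 + -1 = i by ring, ← sub_eq_add_neg] at e
    rw [h1', e, segment_symm]; exact hxi
  exfalso
  have := half_lt_norm_sub_of_mem_segment hP (bdry_mem i) (bdry_mem (i + 1)) (bdry_mem m) h1 h1'
    (norm_bdry_succ_sub i) hxi
  linarith

/-- **A bond meets the boundary polygon only at boundary vertices**: if `k` is not a boundary
vertex, the bond `[p, k]` meets the polygon at most in `p` (bonds do not cross, and bonds at a
common centre meet only there). [cite: HeitmannRadin1980, §4 (p. 284)] -/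
theorem segment_inter_range_subset (hP : IsHard P) {p k : ℂ} (hpk : (p, k) ∈ darts P)
    (hk : k ∉ bdrySet P hne h2) :
    segment ℝ p k ∩ Set.range (polygonLoop (bdry P hne h2) (period P hne h2)) ⊆ {p} := by
  rintro x ⟨hxs, hxR⟩
  rw [range_bdryLoop_eq] at hxR
  obtain ⟨i, hxi⟩ := Set.mem_iUnion.1 hxR
  have hki : k ≠ bdry P hne h2 i := fun h => hk (h ▸ bdry_mem_bdrySet _)
  have hki1 : k ≠ bdry P hne h2 (i + 1) := fun h => hk (h ▸ bdry_mem_bdrySet _)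
  have hkp : k ∈ nbrs P p := mem_nbrs_of_mk_mem_darts hpk
  by_cases hpi : p = bdry P hne h2 i
  · have hs : bdry P hne h2 (i + 1) ∈ nbrs P p := by rw [hpi]; exact bdry_succ_mem_nbrs i
    refine segment_inter_segment_subset hkp hs hki1 ⟨hxs, ?_⟩
    rw [hpi]; exact hxi
  by_cases hpi1 : p = bdry P hne h2 (i + 1)
  · have hs : bdry P hne h2 i ∈ nbrs P p := by
      rw [hpi1]
      have := bdry_pred_mem_nbrs (hne := hne) (h2 := h2) (i + 1)
      rwa [add_sub_cancel_right] at this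
    refine segment_inter_segment_subset hkp hs hki ⟨hxs, ?_⟩
    rw [hpi1, segment_symm]; exact hxi
  · exact absurd hxi (Set.disjoint_left.1
      (disjoint_segment_of_darts hP hpk (bdry_mem_darts i) hpi hpi1 hki hki1) hxs)

/-! ## §2 The traced corners lie outside the boundary polygon -/

/-- **The outer corners are outside.** Every corner traced by the boundary walk lies in the
outside (the unbounded complementary component) of the boundary polygon: the chain of corners of
`exists_preconnected_corners`, joined to the vertical ray below the lowest centre (which misses
the polygon, all of whose points are at least as high), is a connected unbounded set missing the
polygon. [cite: HeitmannRadin1980, §4 (p. 284)] -/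
theorem traceCorner_subset_outside (hP : IsHard P) (m : ℕ) :
    traceCorner P hne h2 m ⊆
      IsJordanLoop.outside (polygonLoop (bdry P hne h2) (period P hne h2)) := by
  classical
  have hπ := Real.pi_pos
  have hT := period_pos (hne := hne) (h2 := h2)
  obtain ⟨U, hU, hUd, hUc⟩ := exists_preconnected_corners (hne := hne) (h2 := h2) hP
  -- the vertical ray below the lowest centre `bdry 0`
  set L : Set ℂ := (fun s : ℝ => bdry P hne h2 0 + s • (-I)) '' Set.Ici (1 / 4 : ℝ) with hL
  have hLpre : IsPreconnected L := IsJordanLoop.isPreconnected_image_ray _ _ _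
  have hLunb : ¬ Bornology.IsBounded L :=
    IsJordanLoop.not_isBounded_image_ray _ _ (neg_ne_zero.2 I_ne_zero) _
  have hLR : L ⊆ (Set.range (polygonLoop (bdry P hne h2) (period P hne h2)))ᶜ := by
    rintro _ ⟨s, hs, rfl⟩ ⟨σ, hσ⟩
    have h1 : (bdry P hne h2 0).im ≤ (polygonLoop (bdry P hne h2) (period P hne h2) σ).im :=
      im_le_im_polygonMap im_bdry_zero_le _
    rw [hσ] at h1
    have hs' : (1 / 4 : ℝ) ≤ s := hs
    simp only [add_im, smul_im, neg_im, I_im, smul_eq_mul] at h1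
    linarith
  -- the corner traced at `bdry 0`, after `bdry (-1)`
  have hq : bdry P hne h2 (-1) ∈ nbrs P (bdry P hne h2 0) := by
    have := bdry_pred_mem_nbrs (hne := hne) (h2 := h2) 0
    rwa [zero_sub] at this
  have hs : bdry P hne h2 1 ∈ nbrs P (bdry P hne h2 0) := by
    have := bdry_succ_mem_nbrs (hne := hne) (h2 := h2) 0
    rwa [zero_add] at this
  have hsucc : succ P (bdry P hne h2 (-1)) (bdry P hne h2 0) = bdry P hne h2 1 := by
    have := bdry_add_two (hne := hne) (h2 := h2) (-1)
    rw [show (-1 : ℤ) + 2 = 1 by norm_num, show (-1 : ℤ) + 1 = 0 by norm_num] at this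
    exact this.symm
  have hz0 : lowest P hne = bdry P hne h2 0 := bdry_zero.symm
  have ha : 0 ≤ arg (bdry P hne h2 (-1) - bdry P hne h2 0) ∧
      arg (bdry P hne h2 (-1) - bdry P hne h2 0) < π := by
    have := arg_sub_lowest_mem hne (k := bdry P hne h2 (-1)) (by rw [hz0]; exact hq)
    rwa [hz0] at this
  have hb : 0 ≤ arg (bdry P hne h2 1 - bdry P hne h2 0) ∧
      arg (bdry P hne h2 1 - bdry P hne h2 0) < π := by
    have := arg_sub_lowest_mem hne (k := bdry P hne h2 1) (by rw [hz0]; exact hs)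
    rwa [hz0] at this
  have hlt : arg (bdry P hne h2 1 - bdry P hne h2 0) < arg (bdry P hne h2 (-1) - bdry P hne h2 0) :=
    arg_bdry_one_lt
  have hgap : gapAngle P (bdry P hne h2 (-1)) (bdry P hne h2 0) =
      arg (bdry P hne h2 1 - bdry P hne h2 0) - arg (bdry P hne h2 (-1) - bdry P hne h2 0) + 2 * π := by
    rw [gapAngle, hsucc]
    refine ccwAngle_eq_of_coe_eq (by linarith) (by linarith) ?_
    rw [show arg (bdry P hne h2 1 - bdry P hne h2 0) - arg (bdry P hne h2 (-1) - bdry P hne h2 0) + 2 * π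
        = (arg (bdry P hne h2 1 - bdry P hne h2 0) - arg (bdry P hne h2 (-1) - bdry P hne h2 0)) + 2 * π
        by ring, Real.Angle.coe_add, Real.Angle.coe_two_pi, add_zero, Real.Angle.coe_sub]
  have hdir : ccwAngle (bdry P hne h2 (-1) - bdry P hne h2 0) (-I) =
      3 * π / 2 - arg (bdry P hne h2 (-1) - bdry P hne h2 0) := by
    refine ccwAngle_eq_of_coe_eq (by linarith) (by linarith) ?_
    rw [arg_neg_I, ← Real.Angle.coe_sub, Real.Angle.angle_eq_iff_two_pi_dvd_sub]
    exact ⟨-1, by push_cast; ring⟩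
  have h4 : (0 : ℝ) < 1 / 4 := by norm_num
  have hx : bdry P hne h2 0 + (1 / 4 : ℝ) • (-I) - bdry P hne h2 0 = ((1 / 4 : ℝ) : ℂ) * (-I) := by
    rw [add_sub_cancel_left, Complex.real_smul]
  have hn : ‖((1 / 4 : ℝ) : ℂ) * (-I)‖ = 1 / 4 := by
    rw [norm_mul, norm_neg, Complex.norm_I, mul_one, Complex.norm_real, Real.norm_eq_abs,
      abs_of_pos h4]
  have hw : bdry P hne h2 0 + (1 / 4 : ℝ) • (-I) ∈ cornerSector P (bdry P hne h2 (-1)) (bdry P hne h2 0) := by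
    rw [cornerSector, mem_sector_iff, hx, hn, ccwAngle_real_mul _ _ h4, hdir, hgap]
    exact ⟨h4, by norm_num, by linarith, by linarith⟩
  have hcorner : traceCorner P hne h2 (0 + period P hne h2 - 1) =
      cornerSector P (bdry P hne h2 (-1)) (bdry P hne h2 0) := by
    have := traceDart_add_period_sub_one (hne := hne) (h2 := h2) 0
    rw [Nat.cast_zero, zero_sub] at this
    simp only [traceCorner, this]
  have hwU : bdry P hne h2 0 + (1 / 4 : ℝ) • (-I) ∈ U := hUc _ (hcorner ▸ hw)
  have hwL : bdry P hne h2 0 + (1 / 4 : ℝ) • (-I) ∈ L := ⟨1 / 4, Set.mem_Ici.2 le_rfl, rfl⟩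
  -- `U ∪ L` is connected, unbounded and misses the polygon
  have hUL : U ∪ L ⊆ IsJordanLoop.outside (polygonLoop (bdry P hne h2) (period P hne h2)) :=
    IsJordanLoop.subset_outside_of_isPreconnected (IsPreconnected.union _ hwU hwL hU hLpre)
      (Set.union_subset (Set.subset_compl_iff_disjoint_right.2
        (hUd.mono_right range_bdryLoop_subset_drawing)) hLR)
      (fun hb => hLunb (hb.subset Set.subset_union_right))
  exact (hUc m).trans (Set.subset_union_left.trans hUL)

/-! ## §3 The inner side at a boundary vertex -/

/-- **The inner sector at a boundary vertex lies inside.** At the boundary vertex `bdry m` the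
open sector opposite to the outer corner (directions at angle `∈ (gapAngle, 2π)` from
`bdry (m-1)`, radii `< 1/2`) lies inside the boundary polygon: near `bdry m` the complement of
the polygon is the outer corner plus this sector, the outer corner is outside, and by the local
two-sidedness of Jordan curves the sector is then inside. [cite: HeitmannRadin1980, §4 (p. 284)] -/
theorem sector_subset_inside (hP : IsHard P) (hns : ¬ Splits P) (m : ℕ) :
    sector (bdry P hne h2 m) (bdry P hne h2 ((m : ℤ) - 1) - bdry P hne h2 m)
        (gapAngle P (bdry P hne h2 ((m : ℤ) - 1)) (bdry P hne h2 m)) (2 * π) (1 / 2) ⊆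
      IsJordanLoop.inside (polygonLoop (bdry P hne h2) (period P hne h2)) := by
  have hπ := Real.pi_pos
  have hJ := (isSimplePolygon_bdry (hne := hne) (h2 := h2) hP hns).isJordanLoop
  have hv : bdry P hne h2 m ∈ P := bdry_mem _
  have ha₁ : bdry P hne h2 ((m : ℤ) - 1) ∈ nbrs P (bdry P hne h2 m) := bdry_pred_mem_nbrs (m : ℤ)
  have hb₁ : bdry P hne h2 ((m : ℤ) + 1) = succ P (bdry P hne h2 ((m : ℤ) - 1)) (bdry P hne h2 m) := by
    have := bdry_add_two (hne := hne) (h2 := h2) ((m : ℤ) - 1)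
    rwa [show (m : ℤ) - 1 + 2 = m + 1 by ring, sub_add_cancel] at this
  have hγ0 : 0 < gapAngle P (bdry P hne h2 ((m : ℤ) - 1)) (bdry P hne h2 m) := by
    have := (gapAngle_mem hP ha₁ (h2 _ hv)).1; linarith
  have hu : ‖bdry P hne h2 ((m : ℤ) - 1) - bdry P hne h2 m‖ = 1 := norm_sub_eq_one_of_mem_nbrs ha₁
  have hvZ : bdry P hne h2 m ∈ Set.range (polygonLoop (bdry P hne h2) (period P hne h2)) :=
    bdry_mem_range _
  -- the two boundary bonds at the vertex lie on the polygon
  have hsa : segment ℝ (bdry P hne h2 m) (bdry P hne h2 ((m : ℤ) - 1)) ⊆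
      Set.range (polygonLoop (bdry P hne h2) (period P hne h2)) := by
    rw [range_bdryLoop_eq, segment_symm]
    refine Set.subset_iUnion_of_subset ((m : ℤ) - 1) ?_
    rw [sub_add_cancel]
  have hsb : segment ℝ (bdry P hne h2 m) (succ P (bdry P hne h2 ((m : ℤ) - 1)) (bdry P hne h2 m)) ⊆
      Set.range (polygonLoop (bdry P hne h2) (period P hne h2)) := by
    rw [range_bdryLoop_eq, ← hb₁]
    exact Set.subset_iUnion_of_subset (m : ℤ) subset_rfl
  -- local two-sidedness at the vertex
  have hsides := hJ.subset_inside_or_of_nhds hvZ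
    (Metric.ball_mem_nhds (bdry P hne h2 m) (by norm_num : (0 : ℝ) < 1 / 2))
    (P := cornerSector P (bdry P hne h2 ((m : ℤ) - 1)) (bdry P hne h2 m))
    (P' := sector (bdry P hne h2 m) (bdry P hne h2 ((m : ℤ) - 1) - bdry P hne h2 m)
      (gapAngle P (bdry P hne h2 ((m : ℤ) - 1)) (bdry P hne h2 m)) (2 * π) (1 / 2))
    ?_ (isPreconnected_cornerSector ha₁) (isPreconnected_sector hu hγ0.le le_rfl) ?_ ?_
  rotate_left
  · -- the punctured ball off the polygon is covered by the two sectors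
    intro x ⟨hxb, hxZ⟩
    rw [Metric.mem_ball, dist_eq_norm] at hxb
    have hxv : x ≠ bdry P hne h2 m := fun e => hxZ (e ▸ hvZ)
    have h0 : 0 < ‖x - bdry P hne h2 m‖ := norm_pos_iff.2 (sub_ne_zero.2 hxv)
    rcases lt_trichotomy (ccwAngle (bdry P hne h2 ((m : ℤ) - 1) - bdry P hne h2 m) (x - bdry P hne h2 m))
      (gapAngle P (bdry P hne h2 ((m : ℤ) - 1)) (bdry P hne h2 m)) with hlt | heq | hgt
    · rcases (ccwAngle_nonneg (bdry P hne h2 ((m : ℤ) - 1) - bdry P hne h2 m)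
        (x - bdry P hne h2 m)).eq_or_lt with h00 | hpos
      · exfalso; apply hxZ; apply hsa
        have := mem_segment_of_ccwAngle_eq (p := bdry P hne h2 m) hu hu hxv (by linarith)
          (by rw [← h00, ccwAngle_self])
        rwa [add_sub_cancel] at this
      · exact Or.inl ⟨h0, hxb, hpos, hlt⟩
    · exfalso; apply hxZ; apply hsb
      have hw : ‖succ P (bdry P hne h2 ((m : ℤ) - 1)) (bdry P hne h2 m) - bdry P hne h2 m‖ = 1 :=
        norm_sub_eq_one_of_mem_nbrs (succ_mem_nbrs ha₁)
      have := mem_segment_of_ccwAngle_eq (p := bdry P hne h2 m) hu hw hxv (by linarith)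
        (by rw [heq, gapAngle])
      rwa [add_sub_cancel] at this
    · exact Or.inr ⟨h0, hxb, hgt, ccwAngle_lt_two_pi _ _⟩
  · exact Set.subset_compl_iff_disjoint_right.2
      ((disjoint_cornerSector_drawing hP hv).mono_right range_bdryLoop_subset_drawing)
  · intro x hx hxZ
    obtain ⟨h0, hxb, hgt, -⟩ := hx
    have hxv : x ≠ bdry P hne h2 m := fun e => by
      rw [e, sub_self, norm_zero] at h0; exact lt_irrefl _ h0
    rcases mem_segment_of_mem_range hP hns (m : ℤ) hxZ hxb with hm | hm
    · have := ccwAngle_eq_of_mem_segment (u := bdry P hne h2 ((m : ℤ) - 1) - bdry P hne h2 m) hm hxv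
      rw [ccwAngle_self] at this
      linarith
    · rw [hb₁] at hm
      have := ccwAngle_eq_of_mem_segment (u := bdry P hne h2 ((m : ℤ) - 1) - bdry P hne h2 m) hm hxv
      rw [← gapAngle] at this
      linarith
  -- the outer corner is outside and non-empty, so the sector is inside
  have hKout : cornerSector P (bdry P hne h2 ((m : ℤ) - 1)) (bdry P hne h2 m) ⊆
      IsJordanLoop.outside (polygonLoop (bdry P hne h2) (period P hne h2)) := by
    rw [cornerSector_bdry_eq_traceCorner]; exact traceCorner_subset_outside hP _
  obtain ⟨x₁, hx₁⟩ := cornerSector_nonempty hP ha₁ (h2 _ hv)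
  rcases hsides with ⟨hK, -⟩ | ⟨-, hS⟩
  · exact absurd (Set.disjoint_left.1 IsJordanLoop.disjoint_inside_outside (hK hx₁) (hKout hx₁))
      not_false
  · exact hS

/-! ## §4 Every centre lies inside or on the boundary polygon -/

/-- **`C_v` lies inside or on the boundary polygon.** For a hard non-splitting configuration
(all degrees `≥ 2`), every centre is inside the boundary polygon or on it: the boundary centres
are on it; a bond from an inside-or-on centre `q` to a non-boundary centre `k` does not meet the
polygon except possibly at `q`, and leaves `q` — if `q` is a boundary vertex — through the inner
sector; so `k` is inside; and the configuration is connected. [cite: HeitmannRadin1980, Theorem (2)(a)] -/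
theorem mem_inside_or_mem_range (hP : IsHard P) (hns : ¬ Splits P) {p : ℂ} (hp : p ∈ P) :
    p ∈ IsJordanLoop.inside (polygonLoop (bdry P hne h2) (period P hne h2)) ∨
      p ∈ Set.range (polygonLoop (bdry P hne h2) (period P hne h2)) := by
  classical
  have hJ := (isSimplePolygon_bdry (hne := hne) (h2 := h2) hP hns).isJordanLoop
  -- the centres inside or on the polygon are closed under bonds
  set G := P.filter fun q => q ∈ IsJordanLoop.inside (polygonLoop (bdry P hne h2) (period P hne h2)) ∨
    q ∈ Set.range (polygonLoop (bdry P hne h2) (period P hne h2)) with hG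
  have hstep : ∀ q ∈ G, ∀ k ∈ nbrs P q, k ∈ G := by
    intro q hqG k hk
    obtain ⟨hqP, hq⟩ := Finset.mem_filter.1 hqG
    have hkP : k ∈ P := (mem_nbrs.1 hk).1
    refine Finset.mem_filter.2 ⟨hkP, ?_⟩
    by_cases hkS : k ∈ bdrySet P hne h2
    · exact Or.inr (bdrySet_subset_range (Finset.mem_coe.2 hkS))
    left
    have hqk : (q, k) ∈ darts P := mk_mem_darts hqP hk
    have hkq : k ≠ q := ne_of_mem_nbrs hk
    have hk1 : ‖k - q‖ = 1 := norm_sub_eq_one_of_mem_nbrs hk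
    -- the bond minus its start `q`
    set S : Set ℂ := (fun s : ℝ => q + s • (k - q)) '' Set.Ioc (0 : ℝ) 1 with hS
    have hSpre : IsPreconnected S := isPreconnected_Ioc.image _ (by fun_prop)
    have hSseg : ∀ s ∈ Set.Ioc (0 : ℝ) 1, q + s • (k - q) ∈ segment ℝ q k ∧ q + s • (k - q) ≠ q := by
      intro s hs
      refine ⟨?_, fun h => ?_⟩
      · rw [segment_eq_image']; exact ⟨s, ⟨hs.1.le, hs.2⟩, rfl⟩
      · rw [add_eq_left, smul_eq_zero] at h
        rcases h with h | h
        · exact hs.1.ne' h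
        · exact hkq (sub_eq_zero.1 h)
    have hSR : S ⊆ (Set.range (polygonLoop (bdry P hne h2) (period P hne h2)))ᶜ := by
      rintro _ ⟨s, hs, rfl⟩ hmem
      obtain ⟨h1, h1'⟩ := hSseg s hs
      exact h1' (Set.mem_singleton_iff.1 (segment_inter_range_subset hP hqk hkS ⟨h1, hmem⟩))
    have hkS' : k ∈ S := ⟨1, ⟨one_pos, le_rfl⟩, by simp⟩
    have hSin : (S ∩ IsJordanLoop.inside (polygonLoop (bdry P hne h2) (period P hne h2))).Nonempty := by
      rcases hq with hq | hq
      · -- `q` is inside, and the inside is open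
        obtain ⟨ε, hε, hball⟩ := Metric.isOpen_iff.1 hJ.isOpen_inside q hq
        have hs0 : 0 < min 1 (ε / 2) := lt_min one_pos (by linarith)
        refine ⟨q + (min 1 (ε / 2)) • (k - q), ⟨min 1 (ε / 2), ⟨hs0, min_le_left _ _⟩, rfl⟩, hball ?_⟩
        rw [Metric.mem_ball, dist_eq_norm, add_sub_cancel_left, norm_smul, hk1, mul_one,
          Real.norm_eq_abs, abs_of_pos hs0]
        linarith [min_le_right 1 (ε / 2)]
      · -- `q` is a boundary vertex: the bond to `k` leaves through the inner sector
        obtain ⟨m, -, rfl⟩ := Finset.mem_image.1 (mem_bdrySet_of_mem_range hP hqP hq)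
        have ha₁ : bdry P hne h2 ((m : ℤ) - 1) ∈ nbrs P (bdry P hne h2 m) := bdry_pred_mem_nbrs (m : ℤ)
        have hka₁ : k ≠ bdry P hne h2 ((m : ℤ) - 1) := fun h => hkS (h ▸ bdry_mem_bdrySet _)
        have hkb₁ : k ≠ succ P (bdry P hne h2 ((m : ℤ) - 1)) (bdry P hne h2 m) := by
          intro h; apply hkS
          have := bdry_add_two (hne := hne) (h2 := h2) ((m : ℤ) - 1)
          rw [show (m : ℤ) - 1 + 2 = m + 1 by ring, sub_add_cancel] at this
          rw [h, ← this]; exact bdry_mem_bdrySet _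
        have hθ1 : gapAngle P (bdry P hne h2 ((m : ℤ) - 1)) (bdry P hne h2 m) <
            ccwAngle (bdry P hne h2 ((m : ℤ) - 1) - bdry P hne h2 m) (k - bdry P hne h2 m) :=
          lt_of_le_of_ne (gapAngle_le_ccwAngle hk hka₁)
            fun h => hkb₁ (eq_succ_of_ccwAngle_eq ha₁ hk h.symm)
        have hθ2 := ccwAngle_lt_two_pi (bdry P hne h2 ((m : ℤ) - 1) - bdry P hne h2 m) (k - bdry P hne h2 m)
        have h4 : (0 : ℝ) < 1 / 4 := by norm_num
        refine ⟨bdry P hne h2 m + (1 / 4 : ℝ) • (k - bdry P hne h2 m),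
          ⟨1 / 4, ⟨h4, by norm_num⟩, rfl⟩, sector_subset_inside hP hns m ?_⟩
        rw [mem_sector_iff, add_sub_cancel_left, norm_smul, hk1, mul_one, Real.norm_eq_abs,
          abs_of_pos h4, Complex.real_smul, ccwAngle_real_mul _ _ h4]
        exact ⟨h4, by norm_num, hθ1, hθ2⟩
    exact hJ.subset_inside_of_inter_nonempty hSpre hSR hSin hkS'
  -- hence they are all the centres (no split)
  have hGP : G = P := by
    by_contra hGne
    apply hns
    have hGsub : G ⊆ P := Finset.filter_subset _ _
    have h0G : bdry P hne h2 0 ∈ G := Finset.mem_filter.2 ⟨bdry_mem 0, Or.inr (bdry_mem_range 0)⟩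
    refine Or.inl ⟨G, P \ G, ⟨_, h0G⟩, ?_, Finset.disjoint_sdiff, Finset.union_sdiff_of_subset hGsub, ?_⟩
    · rw [← Finset.card_pos, Finset.card_sdiff_of_subset hGsub]
      have := Finset.card_lt_card (lt_of_le_of_ne hGsub hGne)
      omega
    · intro a ha b hb hab
      have hb' : b ∈ nbrs P a := mem_nbrs.2 ⟨(Finset.mem_sdiff.1 hb).1, hab⟩
      exact (Finset.mem_sdiff.1 hb).2 (hstep a ha b hb')
  have hpG : p ∈ G := by rw [hGP]; exact hp
  exact (Finset.mem_filter.1 hpG).2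

end Polygon

/-! ## §5 Arithmetic of the triangular lattice `t + u(ℤ + ℤζ)`, `ζ = e^{iπ/3}` -/

section Lattice

/-- Real part of the lattice vector `a + bζ` (`ζ = e^{iπ/3} = ½ + (√3/2) i`).
[cite: HeitmannRadin1980, §2 (p. 283)] -/
theorem re_intComb (a b : ℤ) :
    ((a : ℂ) + (b : ℂ) * Complex.exp (((π / 3 : ℝ) : ℂ) * I)).re = a + b / 2 := by
  rw [exp_pi_div_three_mul_I]; simp; ring

/-- Imaginary part of the lattice vector `a + bζ`. [cite: HeitmannRadin1980, §2 (p. 283)] -/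
theorem im_intComb (a b : ℤ) :
    ((a : ℂ) + (b : ℂ) * Complex.exp (((π / 3 : ℝ) : ℂ) * I)).im = b * (Real.sqrt 3 / 2) := by
  rw [exp_pi_div_three_mul_I]; simp

/-- **The norm form** of Heitmann–Radin's lattice `{m + n exp(iπ/3)}`: `‖a + bζ‖² = a² + ab + b²`
(an integer). [cite: HeitmannRadin1980, §2 (p. 283)] -/
theorem norm_sq_intComb (a b : ℤ) :
    ‖(a : ℂ) + (b : ℂ) * Complex.exp (((π / 3 : ℝ) : ℂ) * I)‖ ^ 2 =
      ((a ^ 2 + a * b + b ^ 2 : ℤ) : ℝ) := by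
  rw [Complex.sq_norm, Complex.normSq_apply, re_intComb, im_intComb]
  have h3 : Real.sqrt 3 * Real.sqrt 3 = 3 := Real.mul_self_sqrt (by norm_num)
  push_cast
  linear_combination ((b : ℝ) ^ 2 / 4) * h3

/-- **A non-zero lattice vector has length at least one**: `a² + ab + b² ≥ 1` unless
`a = b = 0`. [cite: HeitmannRadin1980, §2 (p. 283)] -/
theorem one_le_norm_intComb {a b : ℤ} (h : a ≠ 0 ∨ b ≠ 0) :
    1 ≤ ‖(a : ℂ) + (b : ℂ) * Complex.exp (((π / 3 : ℝ) : ℂ) * I)‖ := by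
  have hN : (1 : ℤ) ≤ a ^ 2 + a * b + b ^ 2 := by
    rcases h with ha | hb
    · nlinarith [sq_nonneg (a + 2 * b), Int.one_le_abs ha, sq_abs a]
    · nlinarith [sq_nonneg (2 * a + b), Int.one_le_abs hb, sq_abs b]
  have h1 : (1 : ℝ) ≤ ‖(a : ℂ) + (b : ℂ) * Complex.exp (((π / 3 : ℝ) : ℂ) * I)‖ ^ 2 := by
    rw [norm_sq_intComb]; exact_mod_cast hN
  nlinarith [norm_nonneg ((a : ℂ) + (b : ℂ) * Complex.exp (((π / 3 : ℝ) : ℂ) * I))]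

/-- **Distinct lattice points are at distance at least one** (the points of a triangular
lattice `t + u(ℤ + ℤζ)`, `|u| = 1`, form a hard configuration). [cite: HeitmannRadin1980, §2 (p. 283)] -/
theorem one_le_norm_sub_of_lattice {u t x y : ℂ} (hu : ‖u‖ = 1)
    (hx : ∃ a b : ℤ, x = t + u * ((a : ℂ) + (b : ℂ) * Complex.exp (((π / 3 : ℝ) : ℂ) * I)))
    (hy : ∃ a b : ℤ, y = t + u * ((a : ℂ) + (b : ℂ) * Complex.exp (((π / 3 : ℝ) : ℂ) * I)))
    (hxy : x ≠ y) : 1 ≤ ‖y - x‖ := by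
  obtain ⟨a, b, rfl⟩ := hx
  obtain ⟨a', b', rfl⟩ := hy
  have e : t + u * ((a' : ℂ) + (b' : ℂ) * Complex.exp (((π / 3 : ℝ) : ℂ) * I)) -
      (t + u * ((a : ℂ) + (b : ℂ) * Complex.exp (((π / 3 : ℝ) : ℂ) * I))) =
      u * (((a' - a : ℤ) : ℂ) + ((b' - b : ℤ) : ℂ) * Complex.exp (((π / 3 : ℝ) : ℂ) * I)) := by
    push_cast; ring
  rw [e, norm_mul, hu, one_mul]
  apply one_le_norm_intComb
  by_contra h
  push Not at h
  obtain ⟨h1, h1'⟩ := h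
  apply hxy
  rw [show a' = a by omega, show b' = b by omega]

/-- **The unit vectors of the triangular lattice are the six powers of `ζ`**: if
`‖a + bζ‖ = 1` then `(a, b) ∈ {(1,0), (0,1), (-1,1), (-1,0), (0,-1), (1,-1)}`, i.e.
`a + bζ = ζ^j` for some `j < 6`. [cite: HeitmannRadin1980, §2 (p. 283)] -/
theorem intComb_eq_pow_of_norm_eq_one {a b : ℤ}
    (h : ‖(a : ℂ) + (b : ℂ) * Complex.exp (((π / 3 : ℝ) : ℂ) * I)‖ = 1) :
    ∃ j : ℕ, j < 6 ∧ (a : ℂ) + (b : ℂ) * Complex.exp (((π / 3 : ℝ) : ℂ) * I) =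
      Complex.exp (((π / 3 : ℝ) : ℂ) * I) ^ j := by
  have hN : a ^ 2 + a * b + b ^ 2 = 1 := by
    have := norm_sq_intComb a b
    rw [h, one_pow] at this
    exact_mod_cast this.symm
  have hb1 : b ≤ 1 := by nlinarith [sq_nonneg (2 * a + b)]
  have hb2 : -1 ≤ b := by nlinarith [sq_nonneg (2 * a + b)]
  have ha1 : a ≤ 1 := by nlinarith [sq_nonneg (a + 2 * b)]
  have ha2 : -1 ≤ a := by nlinarith [sq_nonneg (a + 2 * b)]
  have hz2 := exp_pi_div_three_mul_I_sq
  have hz3 := exp_pi_div_three_mul_I_pow_three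
  set ζ := Complex.exp (((π / 3 : ℝ) : ℂ) * I) with hζ
  rcases (show a = -1 ∨ a = 0 ∨ a = 1 by omega) with rfl | rfl | rfl <;>
    rcases (show b = -1 ∨ b = 0 ∨ b = 1 by omega) with rfl | rfl | rfl
  · norm_num at hN
  · exact ⟨3, by norm_num, by push_cast; linear_combination (-1 : ℂ) * hz3⟩
  · exact ⟨2, by norm_num, by push_cast; linear_combination (-1 : ℂ) * hz2⟩
  · exact ⟨4, by norm_num, by push_cast; linear_combination (-ζ) * hz3⟩
  · norm_num at hN
  · exact ⟨1, by norm_num, by push_cast; ring⟩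
  · exact ⟨5, by norm_num, by push_cast; linear_combination hz2 - ζ ^ 2 * hz3⟩
  · exact ⟨0, by norm_num, by push_cast; ring⟩
  · norm_num at hN

/-- **Lattice directions differ by multiples of `π/3`**: for `u ≠ 0` the counter-clockwise
angle from `u ζ^j` to `u ζ^i` is `m π/3` for some `m < 6`. [cite: HeitmannRadin1980, §2 (p. 283)] -/
theorem ccwAngle_mul_pow_mul_pow {u : ℂ} (hu : u ≠ 0) (j i : ℕ) :
    ∃ m : ℕ, m < 6 ∧
      ccwAngle (u * Complex.exp (((π / 3 : ℝ) : ℂ) * I) ^ j)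
        (u * Complex.exp (((π / 3 : ℝ) : ℂ) * I) ^ i) = m * (π / 3) := by
  have hπ := Real.pi_pos
  have hz6 := exp_pi_div_three_mul_I_pow_six
  set ζ := Complex.exp (((π / 3 : ℝ) : ℂ) * I) with hζ
  have hζ0 : ζ ≠ 0 := Complex.exp_ne_zero _
  obtain ⟨m, hm⟩ : ∃ m : ℕ, m = (i + 6 * (j + 1) - j) % 6 := ⟨_, rfl⟩
  have hm6 : m < 6 := by omega
  refine ⟨m, hm6, ?_⟩
  have hexp : Complex.exp ((((m : ℕ) : ℝ) * (π / 3) : ℝ) * I) = ζ ^ m := by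
    rw [hζ, ← Complex.exp_nat_mul]
    congr 1
    push_cast
    ring
  have key : u * ζ ^ i = u * ζ ^ j * Complex.exp ((((m : ℕ) : ℝ) * (π / 3) : ℝ) * I) := by
    rw [hexp, mul_assoc, ← pow_add]
    congr 1
    have hi : ζ ^ i = ζ ^ (i % 6) := by
      conv_lhs => rw [← Nat.mod_add_div i 6, pow_add, pow_mul, hz6, one_pow, mul_one]
    have hjm : ζ ^ (j + m) = ζ ^ ((j + m) % 6) := by
      conv_lhs => rw [← Nat.mod_add_div (j + m) 6, pow_add, pow_mul, hz6, one_pow, mul_one]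
    rw [hi, hjm]
    congr 1
    omega
  rw [key]
  exact ccwAngle_mul_exp (mul_ne_zero hu (pow_ne_zero _ hζ0)) (by positivity) (by
    have : ((m : ℕ) : ℝ) < 6 := by exact_mod_cast hm6
    nlinarith)

/-- **A unit lattice bond carries no lattice point in its interior** (the bonds of a lattice
configuration are "elementary": "C_g decomposes R² into elementary polygons with unit sides"): a
lattice point on a segment of length `1` issuing from a lattice point is one of its ends (its
distance `s ∈ [0,1]` to the lattice end has `s²` an integer). [cite: HeitmannRadin1980, §4 (p. 284)] -/
theorem eq_or_eq_of_lattice_mem_segment {u t x y y' : ℂ} (hu : ‖u‖ = 1)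
    (hx : ∃ a b : ℤ, x = t + u * ((a : ℂ) + (b : ℂ) * Complex.exp (((π / 3 : ℝ) : ℂ) * I)))
    (hy : ∃ a b : ℤ, y = t + u * ((a : ℂ) + (b : ℂ) * Complex.exp (((π / 3 : ℝ) : ℂ) * I)))
    (h1 : ‖y' - y‖ = 1) (hxs : x ∈ segment ℝ y y') : x = y ∨ x = y' := by
  obtain ⟨s, hs0, hs1, hxe⟩ : ∃ s : ℝ, 0 ≤ s ∧ s ≤ 1 ∧ x = y + s * (y' - y) := by
    rw [segment_eq_image'] at hxs
    obtain ⟨s, ⟨h0, h1⟩, rfl⟩ := hxs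
    exact ⟨s, h0, h1, by simp [Complex.real_smul]⟩
  have hn : ‖x - y‖ = s := by
    rw [hxe, add_sub_cancel_left, norm_mul, Complex.norm_real, Real.norm_eq_abs,
      abs_of_nonneg hs0, h1, mul_one]
  obtain ⟨N, hN⟩ : ∃ N : ℤ, ‖x - y‖ ^ 2 = N := by
    obtain ⟨a, b, hab⟩ := hx
    obtain ⟨a', b', hab'⟩ := hy
    refine ⟨(a - a') ^ 2 + (a - a') * (b - b') + (b - b') ^ 2, ?_⟩
    have e : x - y =
        u * (((a - a' : ℤ) : ℂ) + ((b - b' : ℤ) : ℂ) * Complex.exp (((π / 3 : ℝ) : ℂ) * I)) := by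
      rw [hab, hab']; push_cast; ring
    rw [e, norm_mul, hu, one_mul, norm_sq_intComb]
  rw [hn] at hN
  have hN0 : (0 : ℝ) ≤ N := by rw [← hN]; positivity
  have hN1 : (N : ℝ) ≤ 1 := by rw [← hN]; nlinarith
  have hN' : N = 0 ∨ N = 1 := by
    have h0 : 0 ≤ N := by exact_mod_cast hN0
    have h1 : N ≤ 1 := by exact_mod_cast hN1
    omega
  rcases hN' with rfl | rfl
  · left
    have : s = 0 := by push_cast at hN; nlinarith
    rw [hxe, this]; simp
  · right
    have : s = 1 := by push_cast at hN; nlinarith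
    rw [hxe, this]; simp

/-- **Two unit lattice bonds meet only in common ends** (unit bonds between lattice points do
not cross): a common point of the unit lattice bonds `[y, y']` and `[v, v']` is an end of
`[y, y']`, unless the two bonds coincide (the four ends form a hard configuration:
`disjoint_segment_of_darts`, `segment_inter_segment_subset`). [cite: HeitmannRadin1980, §4 (p. 284)] -/
theorem lattice_segment_inter {u t y y' v v' w : ℂ} (hu : ‖u‖ = 1)
    (hy : ∃ a b : ℤ, y = t + u * ((a : ℂ) + (b : ℂ) * Complex.exp (((π / 3 : ℝ) : ℂ) * I)))
    (hy' : ∃ a b : ℤ, y' = t + u * ((a : ℂ) + (b : ℂ) * Complex.exp (((π / 3 : ℝ) : ℂ) * I)))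
    (hv : ∃ a b : ℤ, v = t + u * ((a : ℂ) + (b : ℂ) * Complex.exp (((π / 3 : ℝ) : ℂ) * I)))
    (hv' : ∃ a b : ℤ, v' = t + u * ((a : ℂ) + (b : ℂ) * Complex.exp (((π / 3 : ℝ) : ℂ) * I)))
    (h1 : ‖y' - y‖ = 1) (h1' : ‖v' - v‖ = 1) (hw : w ∈ segment ℝ y y')
    (hw' : w ∈ segment ℝ v v') : w = y ∨ w = y' ∨ segment ℝ y y' = segment ℝ v v' := by
  classical
  -- the four ends form a hard configuration
  set Q : Finset ℂ := {y, y', v, v'} with hQ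
  have hQhard : IsHard Q := by
    intro p hp q hq hpq
    simp only [hQ, Finset.mem_insert, Finset.mem_singleton] at hp hq
    have hp' : ∃ a b : ℤ, p = t + u * ((a : ℂ) + (b : ℂ) * Complex.exp (((π / 3 : ℝ) : ℂ) * I)) := by
      rcases hp with rfl | rfl | rfl | rfl <;> assumption
    have hq' : ∃ a b : ℤ, q = t + u * ((a : ℂ) + (b : ℂ) * Complex.exp (((π / 3 : ℝ) : ℂ) * I)) := by
      rcases hq with rfl | rfl | rfl | rfl <;> assumption
    exact one_le_norm_sub_of_lattice hu hp' hq' hpq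
  have hyQ : y ∈ Q := by simp [hQ]
  have hy'Q : y' ∈ Q := by simp [hQ]
  have hvQ : v ∈ Q := by simp [hQ]
  have hv'Q : v' ∈ Q := by simp [hQ]
  have hd : (y, y') ∈ darts Q := mem_darts.2 ⟨⟨hyQ, hy'Q⟩, h1⟩
  have hd' : (v, v') ∈ darts Q := mem_darts.2 ⟨⟨hvQ, hv'Q⟩, h1'⟩
  have hq1 : y' ∈ nbrs Q y := mem_nbrs.2 ⟨hy'Q, h1⟩
  have hq2 : y ∈ nbrs Q y' := mem_nbrs.2 ⟨hyQ, by rw [norm_sub_rev]; exact h1⟩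
  by_cases e1 : y = v
  · by_cases e2 : y' = v'
    · right; right; rw [e1, e2]
    · left
      have hk : v' ∈ nbrs Q y := mem_nbrs.2 ⟨hv'Q, by rw [e1]; exact h1'⟩
      exact Set.mem_singleton_iff.1
        (segment_inter_segment_subset hq1 hk e2 ⟨hw, by rw [e1]; exact hw'⟩)
  by_cases e2 : y = v'
  · by_cases e3 : y' = v
    · right; right; rw [e2, e3, segment_symm]
    · left
      have hk : v ∈ nbrs Q y := mem_nbrs.2 ⟨hvQ, by rw [e2, norm_sub_rev]; exact h1'⟩
      exact Set.mem_singleton_iff.1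
        (segment_inter_segment_subset hq1 hk e3 ⟨hw, by rw [e2, segment_symm]; exact hw'⟩)
  by_cases e3 : y' = v
  · right; left
    have hk : v' ∈ nbrs Q y' := mem_nbrs.2 ⟨hv'Q, by rw [e3]; exact h1'⟩
    exact Set.mem_singleton_iff.1
      (segment_inter_segment_subset hq2 hk e2 ⟨by rw [segment_symm]; exact hw, by rw [e3]; exact hw'⟩)
  by_cases e4 : y' = v'
  · right; left
    have hk : v ∈ nbrs Q y' := mem_nbrs.2 ⟨hvQ, by rw [e4, norm_sub_rev]; exact h1'⟩
    exact Set.mem_singleton_iff.1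
      (segment_inter_segment_subset hq2 hk e1
        ⟨by rw [segment_symm]; exact hw, by rw [e4, segment_symm]; exact hw'⟩)
  · exact absurd hw' (Set.disjoint_left.1 (disjoint_segment_of_darts hQhard hd hd' e1 e2 e3 e4) hw)

end Lattice

/-! ## §6 Every lattice point inside or on the boundary polygon is a centre -/

section Fill

variable {hne : P.Nonempty} {h2 : ∀ p ∈ P, 2 ≤ (nbrs P p).card}

/-- **A lattice point on the boundary polygon is a centre** (indeed a boundary vertex: the
boundary bonds are unit lattice bonds). [cite: HeitmannRadin1980, Theorem (2)(a)] -/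
theorem mem_of_lattice_of_mem_range {u t x : ℂ} (hu : ‖u‖ = 1)
    (hΛ : ∀ p ∈ P, ∃ a b : ℤ, p = t + u * ((a : ℂ) + (b : ℂ) * Complex.exp (((π / 3 : ℝ) : ℂ) * I)))
    (hx : ∃ a b : ℤ, x = t + u * ((a : ℂ) + (b : ℂ) * Complex.exp (((π / 3 : ℝ) : ℂ) * I)))
    (hxR : x ∈ Set.range (polygonLoop (bdry P hne h2) (period P hne h2))) : x ∈ P := by
  rw [range_bdryLoop_eq] at hxR
  obtain ⟨i, hxi⟩ := Set.mem_iUnion.1 hxR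
  rcases eq_or_eq_of_lattice_mem_segment hu hx (hΛ _ (bdry_mem i)) (norm_bdry_succ_sub i) hxi
    with rfl | rfl
  · exact bdry_mem i
  · exact bdry_mem (i + 1)

/-- **A lattice neighbour of a centre lying inside or on the polygon is a centre.** Let the
configuration be hard and non-splitting with every corner tight or outer, all centres on the
lattice `t + u(ℤ + ℤζ)`. If `y` is a centre and `y' = y + u ζ^j` lies inside or on the
boundary polygon, then `y'` is a centre: otherwise the direction `y → y'` lies strictly inside a
corner at `y`; a tight one is impossible (lattice directions are `π/3` apart); an outer one has
its sector outside, and then the open lattice bond `(y, y')`, which does not meet the polygon,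
is outside, so `y'` is outside or on the polygon — neither. [cite: HeitmannRadin1980, Theorem (2)(a)] -/
theorem lattice_nbr_mem (hP : IsHard P) (hns : ¬ Splits P)
    (ht : ∀ d ∈ darts P, gapAngle P d.1 d.2 = π / 3 ∨ d ∈ Set.range (traceDart P hne h2))
    {u t : ℂ} (hu : ‖u‖ = 1)
    (hΛ : ∀ p ∈ P, ∃ a b : ℤ, p = t + u * ((a : ℂ) + (b : ℂ) * Complex.exp (((π / 3 : ℝ) : ℂ) * I)))
    {y : ℂ} (hy : y ∈ P) (j : ℕ)
    (hy' : y + u * Complex.exp (((π / 3 : ℝ) : ℂ) * I) ^ j ∈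
        IsJordanLoop.inside (polygonLoop (bdry P hne h2) (period P hne h2)) ∨
      y + u * Complex.exp (((π / 3 : ℝ) : ℂ) * I) ^ j ∈
        Set.range (polygonLoop (bdry P hne h2) (period P hne h2))) :
    y + u * Complex.exp (((π / 3 : ℝ) : ℂ) * I) ^ j ∈ P := by
  classical
  by_contra hy'P
  have hπ := Real.pi_pos
  have hJ := (isSimplePolygon_bdry (hne := hne) (h2 := h2) hP hns).isJordanLoop
  set ζ := Complex.exp (((π / 3 : ℝ) : ℂ) * I) with hζ
  set w := u * ζ ^ j with hw
  have hζ1 : ‖ζ‖ = 1 := norm_exp_pi_div_three_mul_I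
  have hw1 : ‖w‖ = 1 := by rw [hw, norm_mul, norm_pow, hζ1, one_pow, mul_one, hu]
  have hw0 : w ≠ 0 := by rw [← norm_pos_iff, hw1]; norm_num
  have hu0 : u ≠ 0 := by rw [← norm_pos_iff, hu]; norm_num
  -- `y' = y + w` is a lattice point, not on the polygon, hence inside
  have hy'Λ : ∃ a b : ℤ, y + w = t + u * ((a : ℂ) + (b : ℂ) * ζ) := by
    obtain ⟨a, b, hab⟩ := hΛ y hy
    obtain ⟨a', b', hab'⟩ := exists_exp_pi_div_three_mul_I_pow_eq j
    rw [← hζ] at hab'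
    exact ⟨a + a', b + b', by rw [hw, hab, hab']; push_cast; ring⟩
  have hy'R : y + w ∉ Set.range (polygonLoop (bdry P hne h2) (period P hne h2)) :=
    fun h => hy'P (mem_of_lattice_of_mem_range hu hΛ hy'Λ h)
  have hy'in : y + w ∈ IsJordanLoop.inside (polygonLoop (bdry P hne h2) (period P hne h2)) :=
    hy'.resolve_right hy'R
  -- the direction `w` is not a bond direction at `y`, so it lies strictly inside a corner
  have hdir : ∀ k ∈ nbrs P y, ccwAngle (k - y) w ≠ 0 := by
    intro k hk h0
    apply hy'P
    have hk1 := norm_sub_eq_one_of_mem_nbrs hk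
    have : k - y = w := Complex.ext_norm_arg (hk1.trans hw1.symm) (ccwAngle_eq_zero_iff.1 h0)
    rw [← this, add_sub_cancel]
    exact (mem_nbrs.1 hk).1
  obtain ⟨q, hq, hθ0, hθ1⟩ := exists_corner_containing (h2 y hy) hdir
  have hqy : (q, y) ∈ darts P :=
    mem_darts.2 ⟨⟨(mem_nbrs.1 hq).1, hy⟩, by rw [norm_sub_rev]; exact (mem_nbrs.1 hq).2⟩
  rcases ht (q, y) hqy with htight | ⟨i, hi⟩
  · -- a tight corner: the angle from `q - y` to `w` is a multiple of `π/3` in `(0, π/3)`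
    obtain ⟨j', -, hqj'⟩ : ∃ j' : ℕ, j' < 6 ∧ q - y = u * ζ ^ j' := by
      obtain ⟨a, b, hab⟩ := hΛ y hy
      obtain ⟨a', b', hab'⟩ := hΛ q (mem_nbrs.1 hq).1
      have e : q - y = u * (((a' - a : ℤ) : ℂ) + ((b' - b : ℤ) : ℂ) * ζ) := by
        rw [hab, hab']; push_cast; ring
      have hn : ‖((a' - a : ℤ) : ℂ) + ((b' - b : ℤ) : ℂ) * ζ‖ = 1 := by
        have := norm_sub_eq_one_of_mem_nbrs hq
        rwa [e, norm_mul, hu, one_mul] at this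
      obtain ⟨j', hj', hj'e⟩ := intComb_eq_pow_of_norm_eq_one hn
      exact ⟨j', hj', by rw [e, hj'e]⟩
    obtain ⟨m, -, hm⟩ := ccwAngle_mul_pow_mul_pow hu0 j' j
    rw [hqj', hw] at hθ0 hθ1
    rw [← hζ] at hm
    rw [hm] at hθ0 hθ1
    simp only at htight
    rw [htight] at hθ1
    have hm0 : (0 : ℝ) < m := by nlinarith
    have hm1 : (m : ℝ) < 1 := by nlinarith
    have hm0' : 0 < m := by exact_mod_cast hm0
    have hm1' : m < 1 := by exact_mod_cast hm1
    omega
  · -- an outer corner: its sector is outside, and the bond germ towards `y'` lies in it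
    have hK : cornerSector P q y ⊆ IsJordanLoop.outside (polygonLoop (bdry P hne h2) (period P hne h2)) := by
      have := traceCorner_subset_outside (hne := hne) (h2 := h2) hP i
      rwa [traceCorner, hi] at this
    have h4 : (0 : ℝ) < 1 / 4 := by norm_num
    have hptK : y + (1 / 4 : ℝ) • w ∈ cornerSector P q y := by
      rw [cornerSector, mem_sector_iff, add_sub_cancel_left, norm_smul, hw1, mul_one,
        Real.norm_eq_abs, abs_of_pos h4, Complex.real_smul, ccwAngle_real_mul _ _ h4]
      exact ⟨h4, by norm_num, hθ0, hθ1⟩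
    have hpt : y + (1 / 4 : ℝ) • w ∈ openSegment ℝ y (y + w) := by
      rw [openSegment_eq_image']
      exact ⟨1 / 4, ⟨by norm_num, by norm_num⟩, by simp⟩
    -- the open lattice bond `(y, y')` misses the polygon
    have hSR : openSegment ℝ y (y + w) ⊆ (Set.range (polygonLoop (bdry P hne h2) (period P hne h2)))ᶜ := by
      intro p hp hpR
      have hpR' := hpR
      rw [range_bdryLoop_eq] at hpR'
      obtain ⟨i', hpi'⟩ := Set.mem_iUnion.1 hpR'
      rcases lattice_segment_inter hu (hΛ y hy) hy'Λ (hΛ _ (bdry_mem i')) (hΛ _ (bdry_mem (i' + 1)))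
        (by rw [add_sub_cancel_left]; exact hw1) (norm_bdry_succ_sub i')
        (openSegment_subset_segment ℝ _ _ hp) hpi' with rfl | rfl | heq
      · exact hw0 (by have := left_mem_openSegment_iff.1 hp; linear_combination -this)
      · exact hw0 (by have := right_mem_openSegment_iff.1 hp; linear_combination -this)
      · apply hy'R
        rw [range_bdryLoop_eq]
        exact Set.mem_iUnion.2 ⟨i', heq ▸ right_mem_segment ℝ y (y + w)⟩
    rcases hJ.subset_inside_or_subset_outside (convex_openSegment y (y + w)).isPreconnected hSR
      with hin | hout
    · exact Set.disjoint_left.1 IsJordanLoop.disjoint_inside_outside (hin hpt) (hK hptK)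
    · have hcl : y + w ∈ closure (IsJordanLoop.outside (polygonLoop (bdry P hne h2) (period P hne h2))) :=
        closure_mono hout (segment_subset_closure_openSegment (right_mem_segment ℝ y (y + w)))
      rw [hJ.closure_outside_eq] at hcl
      rcases hcl with h | h
      · exact Set.disjoint_left.1 IsJordanLoop.disjoint_inside_outside hy'in h
      · exact hy'R h

/-- **Every lattice point inside or on the boundary polygon is a centre.** With the
configuration as in `lattice_nbr_mem`: if a lattice point `x` inside or on the polygon were not
a centre, then along the lattice ray `x, x + u, x + 2u, …` no point is a centre (by
`lattice_nbr_mem` read backwards) and every point stays inside or on the polygon (a unit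
lattice bond cannot jump over the polygon, `lattice_segment_inter`) — but the inside is
bounded. [cite: HeitmannRadin1980, Theorem (2)(a)] -/
theorem mem_of_lattice (hP : IsHard P) (hns : ¬ Splits P)
    (ht : ∀ d ∈ darts P, gapAngle P d.1 d.2 = π / 3 ∨ d ∈ Set.range (traceDart P hne h2))
    {u t : ℂ} (hu : ‖u‖ = 1)
    (hΛ : ∀ p ∈ P, ∃ a b : ℤ, p = t + u * ((a : ℂ) + (b : ℂ) * Complex.exp (((π / 3 : ℝ) : ℂ) * I)))
    {x : ℂ} (hx : ∃ a b : ℤ, x = t + u * ((a : ℂ) + (b : ℂ) * Complex.exp (((π / 3 : ℝ) : ℂ) * I)))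
    (hxin : x ∈ IsJordanLoop.inside (polygonLoop (bdry P hne h2) (period P hne h2)) ∨
      x ∈ Set.range (polygonLoop (bdry P hne h2) (period P hne h2))) : x ∈ P := by
  classical
  by_contra hxP
  have hJ := (isSimplePolygon_bdry (hne := hne) (h2 := h2) hP hns).isJordanLoop
  have hz3 := exp_pi_div_three_mul_I_pow_three
  obtain ⟨a, b, hab⟩ := hx
  have hkΛ : ∀ k : ℕ, ∃ a' b' : ℤ, x + (k : ℂ) * u =
      t + u * ((a' : ℂ) + (b' : ℂ) * Complex.exp (((π / 3 : ℝ) : ℂ) * I)) :=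
    fun k => ⟨a + k, b, by rw [hab]; push_cast; ring⟩
  -- along the lattice ray every point is inside or on the polygon, and not a centre
  have hall : ∀ k : ℕ,
      (x + (k : ℂ) * u ∈ IsJordanLoop.inside (polygonLoop (bdry P hne h2) (period P hne h2)) ∨
        x + (k : ℂ) * u ∈ Set.range (polygonLoop (bdry P hne h2) (period P hne h2))) ∧
      x + (k : ℂ) * u ∉ P := by
    intro k
    induction k with
    | zero => simpa using ⟨hxin, hxP⟩
    | succ k ih =>
      obtain ⟨hk, hkP⟩ := ih
      have hk1P : x + ((k + 1 : ℕ) : ℂ) * u ∉ P := by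
        intro h
        have key := lattice_nbr_mem hP hns ht hu hΛ h 3 (by
          rw [hz3]
          have e : x + ((k + 1 : ℕ) : ℂ) * u + u * (-1) = x + (k : ℂ) * u := by push_cast; ring
          rw [e]; exact hk)
        rw [hz3] at key
        have e : x + ((k + 1 : ℕ) : ℂ) * u + u * (-1) = x + (k : ℂ) * u := by push_cast; ring
        rw [e] at key
        exact hkP key
      refine ⟨?_, hk1P⟩
      have hkR : x + (k : ℂ) * u ∉ Set.range (polygonLoop (bdry P hne h2) (period P hne h2)) :=
        fun h => hkP (mem_of_lattice_of_mem_range hu hΛ (hkΛ k) h)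
      have hkin : x + (k : ℂ) * u ∈ IsJordanLoop.inside (polygonLoop (bdry P hne h2) (period P hne h2)) :=
        hk.resolve_right hkR
      by_contra hnot
      push Not at hnot
      -- the unit lattice bond from `x + k u` to `x + (k+1) u` leaves the inside: it meets the polygon
      obtain ⟨p, hps, hpR⟩ := hJ.inter_range_nonempty_of_not_subset
        (convex_segment (x + (k : ℂ) * u) (x + ((k + 1 : ℕ) : ℂ) * u)).isPreconnected
        ⟨_, left_mem_segment ℝ _ _, hkin⟩ (fun hsub => hnot.1 (hsub (right_mem_segment ℝ _ _)))
      have hpR' := hpR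
      rw [range_bdryLoop_eq] at hpR'
      obtain ⟨i, hpi⟩ := Set.mem_iUnion.1 hpR'
      have h1 : ‖x + ((k + 1 : ℕ) : ℂ) * u - (x + (k : ℂ) * u)‖ = 1 := by
        rw [show x + ((k + 1 : ℕ) : ℂ) * u - (x + (k : ℂ) * u) = u by push_cast; ring, hu]
      rcases lattice_segment_inter hu (hkΛ k) (hkΛ (k + 1)) (hΛ _ (bdry_mem i)) (hΛ _ (bdry_mem (i + 1)))
        h1 (norm_bdry_succ_sub i) hps hpi with rfl | rfl | heq
      · exact hkR hpR
      · exact hnot.2 hpR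
      · apply hnot.2
        rw [range_bdryLoop_eq]
        exact Set.mem_iUnion.2 ⟨i, heq ▸ right_mem_segment ℝ _ _⟩
  -- but the inside is bounded and the lattice ray is not
  have hbdd : Bornology.IsBounded
      (IsJordanLoop.inside (polygonLoop (bdry P hne h2) (period P hne h2)) ∪
        Set.range (polygonLoop (bdry P hne h2) (period P hne h2))) :=
    hJ.isBounded_inside.union hJ.isCompact_range.isBounded
  obtain ⟨C, hC⟩ := hbdd.exists_norm_le
  obtain ⟨k, hk⟩ := exists_nat_gt (C + ‖x‖)
  have hle : ‖x + (k : ℂ) * u‖ ≤ C := hC _ ((hall k).1.elim (fun h => Or.inl h) fun h => Or.inr h)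
  have hge : (k : ℝ) ≤ ‖x + (k : ℂ) * u‖ + ‖x‖ := by
    have e : ‖(k : ℂ) * u‖ = k := by rw [norm_mul, hu, mul_one, Complex.norm_natCast]
    calc (k : ℝ) = ‖(k : ℂ) * u‖ := e.symm
      _ = ‖(x + (k : ℂ) * u) - x‖ := by rw [add_sub_cancel_left]
      _ ≤ ‖x + (k : ℂ) * u‖ + ‖x‖ := norm_sub_le _ _
  linarith

/-! ## §7 Heitmann–Radin's Theorem (2)(a) -/

/-- **Heitmann–Radin 1980, Theorem (2)(a), as printed.** For every maximal configuration of
`n ≥ 3` unit discs (a hard configuration attaining Harborth's bound `[3n - √(12n-3)]` on the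
number of contact pairs): "(a) `C_g` has a simple closed polygonal boundary with vertices on a
triangular lattice and `C_v` consists of all the lattice points inside and on this polygon" —
the boundary walk `bdry` is a simple closed polygon, and for a congruent copy `t + u(ℤ + ℤζ)`
(`|u| = 1`, `ζ = e^{iπ/3}`) of the triangular lattice containing its vertices, a point is a
centre if and only if it is a lattice point lying inside (in the bounded complementary
component of) or on the boundary polygon. [cite: HeitmannRadin1980, Theorem (2)(a)] -/
theorem HeitmannRadin_polygon (hP : IsHard P) (h3 : 3 ≤ P.card)
    (hmax : 2 * harborthNumber P.card ≤ ((darts P).card : ℤ)) :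
    IsSimplePolygon (bdry P hne h2) (period P hne h2) ∧
    ∃ u t : ℂ, ‖u‖ = 1 ∧
      (∀ m : ℤ, ∃ a b : ℤ,
        bdry P hne h2 m = t + u * ((a : ℂ) + (b : ℂ) * Complex.exp (((π / 3 : ℝ) : ℂ) * I))) ∧
      ∀ x : ℂ, x ∈ P ↔
        (∃ a b : ℤ, x = t + u * ((a : ℂ) + (b : ℂ) * Complex.exp (((π / 3 : ℝ) : ℂ) * I))) ∧
          (x ∈ IsJordanLoop.inside (polygonLoop (bdry P hne h2) (period P hne h2)) ∨
            x ∈ Set.range (polygonLoop (bdry P hne h2) (period P hne h2))) := by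
  have hns : ¬ Splits P := not_splits_of_maximal hP hmax
  have ht := tight_or_outer_of_maximal P.card P hP rfl h3 hmax hne h2
  obtain ⟨u, t, hu, hΛ⟩ := exists_lattice_of_tight hP hns ht
  exact ⟨isSimplePolygon_bdry hP hns, u, t, hu, fun m => hΛ _ (bdry_mem m), fun x =>
    ⟨fun hx => ⟨hΛ x hx, mem_inside_or_mem_range hP hns hx⟩,
      fun hx => mem_of_lattice hP hns ht hu hΛ hx.1 hx.2⟩⟩

/-- **Corollary: the set of centres is the set of lattice points of the closed inside.** With
the boundary polygon a Jordan loop, `closure (inside) = inside ∪ polygon`, so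
`C_v = Λ ∩ closure (inside ∂C_g)` for the lattice `Λ = t + u(ℤ + ℤζ)` of `HeitmannRadin_polygon`.
[cite: HeitmannRadin1980, Theorem (2)(a)] -/
theorem coe_eq_lattice_inter_closure_inside (hP : IsHard P) (h3 : 3 ≤ P.card)
    (hmax : 2 * harborthNumber P.card ≤ ((darts P).card : ℤ)) :
    ∃ u t : ℂ, ‖u‖ = 1 ∧ (P : Set ℂ) =
      {x | ∃ a b : ℤ, x = t + u * ((a : ℂ) + (b : ℂ) * Complex.exp (((π / 3 : ℝ) : ℂ) * I))} ∩
        closure (IsJordanLoop.inside (polygonLoop (bdry P hne h2) (period P hne h2))) := by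
  obtain ⟨hsimple, u, t, hu, -, hiff⟩ := HeitmannRadin_polygon (hne := hne) (h2 := h2) hP h3 hmax
  refine ⟨u, t, hu, ?_⟩
  rw [hsimple.isJordanLoop.closure_inside_eq]
  ext x
  rw [Finset.mem_coe, hiff]
  rfl

end Fill

end Harborth

end Literature.Geometry.DiscreteGeometry

end
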